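import Summits.CriticalPhenomena.SAWScalingLimit.Theorems.SAWLeftRightFKGFKGToTraversalBoundBBBasic
import Summits.CriticalPhenomena.SAWScalingLimit.Theorems.SAWLeftRightFKGFKGToTraversalBoundBBFourPointBody
import HarnessLib

/-!
# Boundary budget (U6), unit BB5, part 1b: the fine body lies in the coarse body, which lies in the closed domain

Crux `SAWLeftRightFKG.FKGToTraversalBound` (stmt-CriticalPhenomena-1878), line `slit-necklace`, lead
prover-line-stmt-CriticalPhenomena-1878-c5-0; wave 6 (the BOUNDARY BUDGET), unit BB5 (the four-point lemma
`bb_four_point`), part 1b, on top of `…BBFourPointBody` (`bbp_bodySet`: the fine body set `A` of a coarse set `B`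
with its box description) and `…BBBasic` (`bb_fullSquare`).

* `bbp_refineFacts` (registered helper) — for a discretised piece `B` of a Dobrushin domain `D` at mesh `δ`
  (mesh points in `D`, lattice-adjacent `B`-sites joined in `D_δ`) and `M ≥ 2`: the fine body set `A` of
  `bbp_bodySet` together with (iv) every point `p ∈ ℂ` all of whose sup-norm-`δ`-close coarse mesh points are
  `B`-sites lies in `closure D` (`p` is a mesh point of `B`, or on a body segment, or in a closed full square of
  `B` — `bb_fullSquare`), and (v) a point failing this hypothesis avoids the `δ / M`-mesh points of `A`, the
  segments between lattice-adjacent `A`-sites and the closed full `δ / M`-squares of `A` (the fine body lies in the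
  coarse body) — the avoidance hypotheses of the sibling `bb_face_chain`.

All statements folklore (lattice bookkeeping in the plane); no literature fact is introduced; nothing restates
the crux.
-/

noncomputable section

open Filter Topology Set Metric
open Literature.Probability.LatticeModels
open Literature.Probability.RandomPlanarGeometry
open Literature.Topology.PlaneTopology

namespace Summit.CriticalPhenomena.SAWScalingLimit.Theorems.FKGToTraversalBound.SlitNecklace

/-! ### Real bookkeeping -/

/-- Unscaling an `η`-multiple inequality. [folklore] -/
private theorem bbp_unscale {η x : ℝ} {M : ℕ} {m : ℤ} (hη : 0 < η)
    (h : |η * x - M * η * m| < M * η) : |x - M * m| < M := by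
  rw [show η * x - M * η * m = η * (x - M * m) by ring, abs_mul, abs_of_pos hη, mul_comm (M : ℝ) η] at h
  exact lt_of_mul_lt_mul_left h hη.le

/-- A real point of the closed segment between the integers `a` and `a + σ` (`|σ| ≤ 1`) lying in the open
`M`-box about `M * m` has one of the two endpoints in that box. [folklore] -/
private theorem bbp_1d {η s : ℝ} {M : ℕ} {a m σ : ℤ} (hη : 0 < η) (hs0 : 0 ≤ s) (hs1 : s ≤ 1)
    (hσ : |σ| ≤ 1) (h : |η * ((a : ℝ) + s * σ) - M * η * m| < M * η) :
    |a - M * m| < M ∨ |a + σ - M * m| < M := by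
  have h' := bbp_unscale hη h
  by_contra hcon
  push Not at hcon
  obtain ⟨h1, h2⟩ := hcon
  rw [abs_lt] at h'
  rw [abs_le] at hσ
  have hσ1 : (σ : ℝ) ≤ 1 := by exact_mod_cast hσ.2
  have hσ2 : (-1 : ℝ) ≤ σ := by exact_mod_cast hσ.1
  have hMpos : (0 : ℝ) < M := by linarith
  have hM1 : (1 : ℝ) ≤ M := by
    have : M ≠ 0 := by rintro rfl; simp at hMpos
    exact_mod_cast Nat.one_le_iff_ne_zero.2 this
  have h1' : (M : ℝ) ≤ |(a : ℝ) - M * m| := by exact_mod_cast h1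
  have h2' : (M : ℝ) ≤ |(a : ℝ) + σ - M * m| := by exact_mod_cast h2
  rcases le_abs'.1 h1' with h1' | h1' <;> rcases le_abs'.1 h2' with h2' | h2'
  · nlinarith [mul_nonneg hs0 (by linarith : (0 : ℝ) ≤ -M - ((a : ℝ) + σ - M * m)),
      mul_nonneg (by linarith : (0 : ℝ) ≤ 1 - s) (by linarith : (0 : ℝ) ≤ -M - ((a : ℝ) - M * m))]
  · linarith
  · linarith
  · nlinarith [mul_nonneg hs0 (by linarith : (0 : ℝ) ≤ ((a : ℝ) + σ - M * m) - M),
      mul_nonneg (by linarith : (0 : ℝ) ≤ 1 - s) (by linarith : (0 : ℝ) ≤ ((a : ℝ) - M * m) - M)]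

/-! ### The coarse body lies in the closed domain -/

/-- **A point all of whose sup-norm-close coarse sites lie in `B` belongs to `closure D`**: it is a mesh point of
`B`, or on a body edge, or in a full square of `B` (the last case is the sibling `bb_fullSquare`). [folklore] -/
private theorem bbp_closure_of_kbr {D : DobrushinDomain} {δ : ℝ} {B : Finset (Site 2)} (hδ : 0 < δ)
    (hBD : ∀ x ∈ B, meshPoint δ x ∈ D.carrier)
    (hBadj : ∀ x ∈ B, ∀ x' ∈ B, (zdGraph 2).Adj x x' → (discreteDomainGraph D.carrier δ).Adj x x')
    {p : ℂ} (hp : ∀ z : Site 2, |p.re - δ * z 0| < δ → |p.im - δ * z 1| < δ → z ∈ B) :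
    p ∈ closure D.carrier := by
  have hseg : ∀ x ∈ B, ∀ d : ODir, x + d.vec ∈ B →
      segment ℝ (meshPoint δ x) (meshPoint δ (x + d.vec)) ⊆ closure D.carrier := fun x hx d hxd =>
    (meshGraph_adj_iff.1 (discreteDomainGraph_adj_iff.1 (hBadj x hx _ hxd (ODir.adj_add_vec x d))).1).2
  obtain ⟨u₀, hu₀, hu₀1, hre⟩ : ∃ u : ℝ, 0 ≤ u ∧ u < 1 ∧ p.re = δ * ⌊p.re / δ⌋ + δ * u :=
    ⟨p.re / δ - ⌊p.re / δ⌋, by linarith [Int.floor_le (p.re / δ)],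
      by linarith [Int.lt_floor_add_one (p.re / δ)], by field_simp; ring⟩
  obtain ⟨u₁, hu₁, hu₁1, him⟩ : ∃ u : ℝ, 0 ≤ u ∧ u < 1 ∧ p.im = δ * ⌊p.im / δ⌋ + δ * u :=
    ⟨p.im / δ - ⌊p.im / δ⌋, by linarith [Int.floor_le (p.im / δ)],
      by linarith [Int.lt_floor_add_one (p.im / δ)], by field_simp; ring⟩
  generalize ⌊p.re / δ⌋ = q₀ at hre
  generalize ⌊p.im / δ⌋ = q₁ at him
  set q : Site 2 := ![q₀, q₁] with hq_def
  have hq0 : q 0 = q₀ := rfl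
  have hq1 : q 1 = q₁ := rfl
  have aux : ∀ (u : ℝ) (a e : ℤ), 0 ≤ u → u < 1 → (e = 0 ∨ (e = 1 ∧ u ≠ 0)) →
      |δ * a + δ * u - δ * ((a + e : ℤ) : ℝ)| < δ := by
    intro u a e hu0 hu1 he
    rcases he with rfl | ⟨rfl, hne⟩
    · push_cast
      rw [show δ * a + δ * u - δ * (a + 0) = δ * u by ring, abs_lt]
      constructor <;> nlinarith
    · have : 0 < u := lt_of_le_of_ne hu0 (Ne.symm hne)
      push_cast
      rw [show δ * a + δ * u - δ * (a + 1) = δ * (u - 1) by ring, abs_lt]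
      constructor <;> nlinarith
  have near : ∀ ε : Site 2, (ε 0 = 0 ∨ (ε 0 = 1 ∧ u₀ ≠ 0)) → (ε 1 = 0 ∨ (ε 1 = 1 ∧ u₁ ≠ 0)) →
      q + ε ∈ B := by
    intro ε h0 h1
    apply hp
    · rw [hre]
      exact aux u₀ q₀ (ε 0) hu₀ hu₀1 h0
    · rw [him]
      exact aux u₁ q₁ (ε 1) hu₁ hu₁1 h1
  have hq : q ∈ B := by simpa using near 0 (Or.inl rfl) (Or.inl rfl)
  have e00 : (ODir.vec 0 : Site 2) 0 = 1 := by simp [ODir.vec]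
  have e01 : (ODir.vec 0 : Site 2) 1 = 0 := by simp [ODir.vec]
  have e10 : (ODir.vec 1 : Site 2) 0 = 0 := by simp [ODir.vec]
  have e11 : (ODir.vec 1 : Site 2) 1 = 1 := by simp [ODir.vec]
  by_cases h0 : u₀ = 0 <;> by_cases h1 : u₁ = 0
  · have : p = meshPoint δ q := Complex.ext (by simp [hre, h0, hq0]) (by simp [him, h1, hq1])
    rw [this]
    exact subset_closure (hBD q hq)
  · refine hseg q hq 1 (near _ (Or.inl e10) (Or.inr ⟨e11, h1⟩)) ?_
    rw [segment_eq_image']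
    refine ⟨u₁, ⟨hu₁, hu₁1.le⟩, Complex.ext ?_ ?_⟩
    · simp [hre, h0, hq0, e10]
    · simp [him, hq1, e11]
      ring
  · refine hseg q hq 0 (near _ (Or.inr ⟨e00, h0⟩) (Or.inl e01)) ?_
    rw [segment_eq_image']
    refine ⟨u₀, ⟨hu₀, hu₀1.le⟩, Complex.ext ?_ ?_⟩
    · simp [hre, hq0, e00]
      ring
    · simp [him, h1, hq1, e01]
  · have hq0' : q + ODir.vec 0 ∈ B := near _ (Or.inr ⟨e00, h0⟩) (Or.inl e01)
    have hq1' : q + ODir.vec 1 ∈ B := near _ (Or.inl e10) (Or.inr ⟨e11, h1⟩)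
    have hq01 : q + ODir.vec 0 + ODir.vec 1 ∈ B := by
      rw [add_assoc]
      exact near _ (Or.inr ⟨by simp [e00, e10], h0⟩) (Or.inr ⟨by simp [e01, e11], h1⟩)
    have hq10 : q + ODir.vec 1 + ODir.vec 0 ∈ B := by rwa [add_right_comm]
    refine bb_fullSquare D δ q hδ (hBD q hq) (hBD _ hq0') (hBD _ hq1') (hBD _ hq01) (hseg q hq 0 hq0')
      (hseg q hq 1 hq1') (hseg _ hq0' 1 hq01) ?_ p ⟨?_, ?_, ?_, ?_⟩
    · have := hseg _ hq1' 0 hq10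
      rwa [add_right_comm] at this
    · simp [hre, hq0]
      nlinarith
    · simp [hre, hq0]
      nlinarith
    · simp [him, hq1]
      nlinarith
    · simp [him, hq1]
      nlinarith

/-! ### The fine body lies in the coarse body -/

/-- Points of the fine body (mesh points of `A`, segments between lattice-adjacent `A`-sites, closed full
`η`-squares of `A`) have all their sup-norm-close coarse sites in `B`; stated contrapositively for a point `p`
that fails this. [folklore] -/
private theorem bbp_avoid_of_not_kbr {B A : Finset (Site 2)} {M : ℕ} {δ : ℝ} (hM : 2 ≤ M) (hδ : 0 < δ)
    (hA : ∀ f : Site 2, f ∈ A ↔ ∀ z : Site 2, (∀ i, |(M : ℤ) * z i - f i| < M) → z ∈ B) {p : ℂ}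
    (hp : ¬ ∀ z : Site 2, |p.re - δ * z 0| < δ → |p.im - δ * z 1| < δ → z ∈ B) :
    (∀ f ∈ A, p ≠ meshPoint (δ / M) f) ∧
    (∀ f ∈ A, ∀ d : ODir, f + d.vec ∈ A → p ∉ segment ℝ (meshPoint (δ / M) f) (meshPoint (δ / M) (f + d.vec))) ∧
    (∀ f : Site 2, f ∈ A → f + ODir.vec 0 ∈ A → f + ODir.vec 1 ∈ A → f + ODir.vec 0 + ODir.vec 1 ∈ A →
      ¬ ((meshPoint (δ / M) f).re ≤ p.re ∧ p.re ≤ (meshPoint (δ / M) f).re + δ / M ∧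
        (meshPoint (δ / M) f).im ≤ p.im ∧ p.im ≤ (meshPoint (δ / M) f).im + δ / M)) := by
  have hM0 : 0 < M := by omega
  set η : ℝ := δ / M with hη_def
  have hη : 0 < η := div_pos hδ (by exact_mod_cast hM0)
  have hδη : δ = M * η := by rw [hη_def]; field_simp
  -- the common core: a fine site `g ∈ A` whose box contains `p / η` certifies the KBR property at `p`
  have core : ∀ z : Site 2, (∃ g ∈ A, ∀ i, |g i - (M : ℤ) * z i| < M) → z ∈ B := by
    rintro z ⟨g, hg, hgz⟩
    refine (hA g).1 hg z fun i => ?_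
    rw [abs_sub_comm]
    exact hgz i
  refine ⟨?_, ?_, ?_⟩
  · rintro f hf rfl
    refine hp fun z h0 h1 => core z ⟨f, hf, fun i => ?_⟩
    fin_cases i
    · have := bbp_unscale hη (x := (f 0 : ℝ)) (m := z 0) (by simpa [meshPoint_re, hδη] using h0)
      exact_mod_cast this
    · have := bbp_unscale hη (x := (f 1 : ℝ)) (m := z 1) (by simpa [meshPoint_im, hδη] using h1)
      exact_mod_cast this
  · rintro f hf d hfd hmem
    rw [segment_eq_image'] at hmem
    obtain ⟨s, ⟨hs0, hs1⟩, rfl⟩ := hmem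
    refine hp fun z h0 h1 => ?_
    have alt : ∀ i, |f i - (M : ℤ) * z i| < M ∨ |f i + d.vec i - (M : ℤ) * z i| < M := by
      intro i
      have key : |η * ((f i : ℝ) + s * (d.vec i)) - M * η * z i| < M * η := by
        fin_cases i
        · convert h0 using 2
          · simp [meshPoint_re, hδη]
            ring
          · rw [hδη]
        · convert h1 using 2
          · simp [meshPoint_im, hδη]
            ring
          · rw [hδη]
      exact bbp_1d hη hs0 hs1 (ODir.abs_vec_apply_le d i) key
    apply core z
    rcases alt 0 with a0 | a0 <;> rcases alt 1 with a1 | a1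
    · exact ⟨f, hf, fun i => by fin_cases i <;> assumption⟩
    · rcases bbp_vec_axis d with hd | hd
      · refine ⟨f + d.vec, hfd, fun i => ?_⟩
        fin_cases i
        · simpa [hd] using a0
        · simpa using a1
      · refine ⟨f, hf, fun i => ?_⟩
        fin_cases i
        · exact a0
        · simpa [hd] using a1
    · rcases bbp_vec_axis d with hd | hd
      · refine ⟨f, hf, fun i => ?_⟩
        fin_cases i
        · simpa [hd] using a0
        · exact a1
      · refine ⟨f + d.vec, hfd, fun i => ?_⟩
        fin_cases i
        · simpa using a0
        · simpa [hd] using a1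
    · exact ⟨f + d.vec, hfd, fun i => by fin_cases i <;> simpa using ‹_›⟩
  · rintro f hf hf0 hf1 hf01 ⟨hr0, hr1, hi0, hi1⟩
    refine hp fun z h0 h1 => ?_
    simp only [meshPoint_re, meshPoint_im] at hr0 hr1 hi0 hi1
    have alt : ∀ i, |f i - (M : ℤ) * z i| < M ∨ |f i + 1 - (M : ℤ) * z i| < M := by
      intro i
      obtain ⟨s, hs0, hs1, hs⟩ : ∃ s : ℝ, 0 ≤ s ∧ s ≤ 1 ∧
          (if i = 0 then p.re else p.im) = η * ((f i : ℝ) + s * ((1 : ℤ) : ℝ)) := by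
        fin_cases i
        · refine ⟨(p.re - η * f 0) / η, div_nonneg (by linarith) hη.le,
            (div_le_one hη).2 (by linarith), ?_⟩
          simp
          field_simp
          ring
        · refine ⟨(p.im - η * f 1) / η, div_nonneg (by linarith) hη.le,
            (div_le_one hη).2 (by linarith), ?_⟩
          simp
          field_simp
          ring
      have key : |η * ((f i : ℝ) + s * ((1 : ℤ) : ℝ)) - M * η * z i| < M * η := by
        rw [← hs]
        fin_cases i
        · simpa [hδη] using h0
        · simpa [hδη] using h1
      exact bbp_1d hη hs0 hs1 (by simp) key
    apply core z
    rcases alt 0 with a0 | a0 <;> rcases alt 1 with a1 | a1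
    · exact ⟨f, hf, fun i => by fin_cases i <;> assumption⟩
    · exact ⟨f + ODir.vec 1, hf1, fun i => by fin_cases i <;> simpa [ODir.vec] using ‹_›⟩
    · exact ⟨f + ODir.vec 0, hf0, fun i => by fin_cases i <;> simpa [ODir.vec] using ‹_›⟩
    · exact ⟨f + ODir.vec 0 + ODir.vec 1, hf01, fun i => by fin_cases i <;> simpa [ODir.vec] using ‹_›⟩

/-! ### The registered helper -/

/-- **U6 BB5, part 1b (registered helper): the fine body set and its plane geometry.**  For a discretised piece
`B` of the Dobrushin domain `D` at mesh `δ` and `M ≥ 2`: a fine site set `A` with (i) the three-way membership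
description, (ii) the box description, (iii) no pinch, (iv) points all of whose sup-norm-close coarse sites lie in
`B` are in `closure D`, (v) points failing this avoid the fine body of `A` at mesh `δ / M`. [folklore] -/
theorem bbp_refineFacts : ∀ (D : DobrushinDomain) (δ : ℝ) (B : Finset (Site 2)) (M : ℕ), 0 < δ → 2 ≤ M → (∀ x ∈ B, meshPoint δ x ∈ D.carrier) → (∀ x ∈ B, ∀ x' ∈ B, (zdGraph 2).Adj x x' → (discreteDomainGraph D.carrier δ).Adj x x') → ∃ A : Finset (Site 2), (∀ f : Site 2, f ∈ A ↔ ((∃ x ∈ B, f = (M : ℤ) • x) ∨ (∃ x ∈ B, ∃ d : ODir, x + d.vec ∈ B ∧ ∃ t : ℤ, 0 < t ∧ t < M ∧ f = (M : ℤ) • x + t • d.vec) ∨ (∃ x ∈ B, x + ODir.vec 0 ∈ B ∧ x + ODir.vec 1 ∈ B ∧ x + ODir.vec 0 + ODir.vec 1 ∈ B ∧ ∃ t₁ t₂ : ℤ, 0 < t₁ ∧ t₁ < M ∧ 0 < t₂ ∧ t₂ < M ∧ f = (M : ℤ) • x + t₁ • ODir.vec 0 + t₂ • ODir.vec 1)))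 ∧ (∀ f : Site 2, f ∈ A ↔ (∀ z : Site 2, (∀ i, |(M : ℤ) * z i - f i| < M) → z ∈ B)) ∧ (∀ f : Site 2, ((f ∈ A → f + ODir.vec 0 + ODir.vec 1 ∈ A → f + ODir.vec 0 ∈ A ∨ f + ODir.vec 1 ∈ A) ∧ (f + ODir.vec 0 ∈ A → f + ODir.vec 1 ∈ A → f ∈ A ∨ f + ODir.vec 0 + ODir.vec 1 ∈ A))) ∧ (∀ p : ℂ, (∀ z : Site 2, |p.re - δ * z 0| < δ → |p.im - δ * z 1| < δ → z ∈ B) → p ∈ closure D.carrier) ∧ (∀ p : ℂ, (¬ (∀ z : Site 2, |p.re - δ * z 0| < δ → |p.im - δ * z 1| < δ → z ∈ B)) → ((∀ f ∈ A, p ≠ meshPoint (δ / M) f) ∧ (∀ f ∈ A, ∀ d : ODir, f + d.vec ∈ A → p ∉ segment ℝ (meshPoint (δ / M) f) (meshPoint (δ / M) (f + d.vec))) ∧ (∀ f : Site 2, f ∈ A → f + ODir.vec 0 ∈ A → f + ODir.vec 1 ∈ A → f + ODir.vec 0 + ODir.vec 1 ∈ A → ¬ ((meshPoint (δ / M) f).re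 ≤ p.re ∧ p.re ≤ (meshPoint (δ / M) f).re + δ / M ∧ (meshPoint (δ / M) f).im ≤ p.im ∧ p.im ≤ (meshPoint (δ / M) f).im + δ / M)))) := by
  intro D δ B M hδ hM hBD hBadj
  obtain ⟨A, hA, hAbox, hnp⟩ := bbp_bodySet B M hM
  exact ⟨A, hA, hAbox, hnp, fun p hp => bbp_closure_of_kbr hδ hBD hBadj hp,
    fun p hp => bbp_avoid_of_not_kbr hM hδ hAbox hp⟩

end Summit.CriticalPhenomena.SAWScalingLimit.Theorems.FKGToTraversalBound.SlitNecklace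

end
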